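import Mathlib.NumberTheory.LSeries.Deriv
import Literature.NumberTheory.LFunctions.ChebyshevHalfLineBiasVariants
import Literature.NumberTheory.LFunctions.HalfLinePrimeSumLandau
import HarnessLib

/-!
# RH-IMPLYING criterion (Suzuki 2025, Thm 5, first assertion), PROVED — «nothing here bears on the truth of RH»
# `Σ_{p ≤ xe²} log p · √(x/p) log(x/p) → −∞` implies RH: discharge of `Suzuki2025Chebyshev_thm5`

M. Suzuki, *On variants of Chebyshev's conjecture*, Ramanujan J. **68** (2025), no. 4, art. 95 = arXiv:2411.07436
[`Suzuki2025Chebyshev`; PUBLISHED, refereed], **Theorem 5, first assertion** (§1.2), AS PRINTED: «The RH holds assuming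
`lim_{x→∞} Σ_{p ≤ xe²} log p · √(x/p) log(x/p) = −∞` (1.20).» This is the named fact `Suzuki2025Chebyshev_thm5` of
`ChebyshevHalfLineBiasVariants.lean` (RH literature-typing tranche 1), DISCHARGED here:
`Suzuki2025Chebyshev_thm5_holds`. It is an RH-FREE implication whose hypothesis the paper calls «a conclusion stronger
than the RH, similar to Theorem 2»; nothing in this file is, or is worded as, progress toward RH. Theorems only: no
definitions, no named facts (D-0014/D-0026).

## The printed proof (§4.3, referring to §4.2) and this formalisation

§4.3: «It suffices to show (1.20) with `x` replaced by `x/e²`. Using the decomposition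
`Σ_{n ≤ x} Λ(n) n^{-1/2} log(x/(ne²)) = Σ_{p ≤ x} (log p/√p)(log(x/p) − 2) + Σ_{p ≤ √x} (log p/p)(log(x/p²) − 2)
 + Σ_{k ≥ 3} Σ_{p ≤ x^{1/k}} (log p/p^{k/2})(log(x/p^k) − 2)` and (2.1), it can be obtained by an argument similar to that
of Theorem 4», i.e. of Theorem 9, §4.2: the Mellin transform of the prime-only sum `f₁` is, up to the factor
`(s − ½)^{-2}`, the prime part of `L'/L`; the higher prime powers (`f₂`, `f₃`) contribute transforms that «converge
absolutely and uniformly on any compact subset in `Re(s) > 1/2`, and hence define analytic functions there» ((4.11));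
and Landau's theorem for the Laplace transform of an eventually one-signed function (§2 Prop. 1) then forbids poles of
the logarithmic derivative — zeros — in `Re(s) > 1/2`.

Here, in the Landau variable `S = s − ½` and with `e^t = xe²` (exactly as in the tree's proof of Thm 2, first assertion,
`HalfLinePrimeSumLandau.lean`, whose engine is reused):
* the hypothesis gives `G₁(t) := Σ_{p ≤ e^t} (log p/√p)(2 − t + log p) = −x^{-1/2} Σ_{p ≤ xe²} log p √(x/p) log(x/p) ≥ 0`
  for `t > log x₀ + 2` (`x = e^{t−2}`);
* termwise (`∫₀^∞ 𝟙[log p ≤ t] e^{−St} dt = p^{−S}/S`, `∫₀^∞ (t − log p)₊ e^{−St} dt = p^{−S}/S²`, the interchange by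
  absolute convergence, dominated by `L(Λ, ½ + Re S)`), for `Re S > 1`:
  `∫₀^∞ G₁(t) e^{−St} dt = (2S − 1) S^{−2} Σ_p log p · p^{−1/2−S}` (`HalfLinePrimeOnlyLandau.laplace_two_count_sub_weighted`,
  stated for any coefficient `0 ≤ d ≤ Λ` in place of `log p · 𝟙_{prime}`);
* `Σ_p log p · p^{−w} = L(Λ, w) − L(Λ·𝟙_{not prime}, w)` and `L(Λ, w) = 1/(w − 1) − ζ₁'/ζ₁(w)` (`ζ₁(w) = (w−1)ζ(w)`;
  the tree's `logDeriv_riemannZeta₁_eq_of_one_lt_re`), so the transform is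
  `((1 − 2S)·ζ₁'/ζ₁(½ + S) + P(S))/S²` with `P(S) = 2 + (1 − 2S)·L(Λ·𝟙_{not prime}, ½ + S)`;
* `P` is holomorphic on `Re S > 0` because `Σ_p Σ_{k ≥ 2} log p · p^{−ky} < ∞` for every real `y > 1/2` — the printed
  «analytic in `Re s > 1/2`» of (4.11) (`HalfLinePrimeOnlyLandau.abscissaOfAbsConv_vonMangoldt_nonPrime_le`: the
  injective re-indexing `(p, k) ↦ p^{k+2}`, a geometric series in `k`, `log p ≤ p^δ/δ` and `Σ_p p^{−1−δ} < ∞`); and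
  `1 − 2S ≠ 0` for `Re S < 1/2`;
* Landau's theorem in the form `HalfLinePrimeSumLandau.riemannHypothesis_of_laplace_eq_mul` ([Suzuki2025Chebyshev, §2
  Prop 1]; the tree's engine) gives RH.
Deviation from print: none in substance. The asymptotics (4.9)–(4.10) of `f₂`, `f₃` via Mertens' (2.1) are not needed
for the first assertion (they serve the converse, `Suzuki2025Chebyshev_thm5_converse`, not proved here); only the
holomorphy of their transforms on `Re s > 1/2` is, as in (4.11).

## References
* [Suzuki2025Chebyshev] M. Suzuki, Ramanujan J. 68 (2025) 95 = arXiv:2411.07436: Thm 5 (§1.2), §4.3, §4.2 (Thm 9,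
  (4.11)), §2 Prop 1 (Landau), §3.1/§3.3 (the termwise Mellin transforms).
-/

noncomputable section

open Complex Filter Topology Set MeasureTheory ArithmeticFunction
open scoped Real LSeries.notation

namespace Literature.NumberTheory.LFunctions

namespace HalfLinePrimeOnlyLandau

variable {a : ℂ} {d : ℕ → ℝ}

/-! ### Weighted prime-power counts `A_d(t) = Σ_{n ≤ e^t} d(n)/√n`, `φ_d(t) = Σ_{n ≤ e^t} d(n)/√n (t − log n)` -/

/-- `A_d` is non-decreasing for `d ≥ 0`. [folklore] -/
private theorem monotone_count (hd0 : ∀ n, 0 ≤ d n) :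
    Monotone fun t : ℝ ↦ ∑ n ∈ Finset.Icc 1 ⌊Real.exp t⌋₊, d n / Real.sqrt n := by
  intro t u htu
  refine Finset.sum_le_sum_of_subset_of_nonneg
    (Finset.Icc_subset_Icc_right (Nat.floor_mono (Real.exp_le_exp.2 htu))) fun n _ _ ↦ ?_
  exact div_nonneg (hd0 n) (Real.sqrt_nonneg _)

/-- `B_d(t) = Σ_{n ≤ e^t} d(n) log n/√n` is non-decreasing for `d ≥ 0`. [folklore] -/
private theorem monotone_countLog (hd0 : ∀ n, 0 ≤ d n) :
    Monotone fun t : ℝ ↦ ∑ n ∈ Finset.Icc 1 ⌊Real.exp t⌋₊, d n / Real.sqrt n * Real.log n := by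
  intro t u htu
  refine Finset.sum_le_sum_of_subset_of_nonneg
    (Finset.Icc_subset_Icc_right (Nat.floor_mono (Real.exp_le_exp.2 htu))) fun n _ _ ↦ ?_
  exact mul_nonneg (div_nonneg (hd0 n) (Real.sqrt_nonneg _)) (Real.log_natCast_nonneg n)

/-- `A_d` is measurable (it is monotone). [folklore] -/
private theorem measurable_count (hd0 : ∀ n, 0 ≤ d n) :
    Measurable fun t : ℝ ↦ ∑ n ∈ Finset.Icc 1 ⌊Real.exp t⌋₊, d n / Real.sqrt n :=
  (monotone_count hd0).measurable

/-- `φ_d(t) = t A_d(t) − B_d(t)` is measurable. [folklore] -/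
private theorem measurable_weighted (hd0 : ∀ n, 0 ≤ d n) :
    Measurable fun t : ℝ ↦ ∑ n ∈ Finset.Icc 1 ⌊Real.exp t⌋₊, d n / Real.sqrt n * (t - Real.log n) := by
  have h : (fun t : ℝ ↦ ∑ n ∈ Finset.Icc 1 ⌊Real.exp t⌋₊, d n / Real.sqrt n * (t - Real.log n)) =
      fun t ↦ t * (∑ n ∈ Finset.Icc 1 ⌊Real.exp t⌋₊, d n / Real.sqrt n)
        - ∑ n ∈ Finset.Icc 1 ⌊Real.exp t⌋₊, d n / Real.sqrt n * Real.log n := by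
    funext t
    rw [Finset.mul_sum, ← Finset.sum_sub_distrib]
    refine Finset.sum_congr rfl fun n _ ↦ ?_
    ring
  rw [h]
  exact (measurable_id.mul (measurable_count hd0)).sub (monotone_countLog hd0).measurable

/-- `A_d ≥ 0` for `d ≥ 0`. [folklore] -/
private theorem count_nonneg (hd0 : ∀ n, 0 ≤ d n) (t : ℝ) :
    0 ≤ ∑ n ∈ Finset.Icc 1 ⌊Real.exp t⌋₊, d n / Real.sqrt n :=
  Finset.sum_nonneg fun n _ ↦ div_nonneg (hd0 n) (Real.sqrt_nonneg _)

/-- `φ_d ≥ 0` for `d ≥ 0`. [folklore] -/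
private theorem weighted_nonneg (hd0 : ∀ n, 0 ≤ d n) (t : ℝ) :
    0 ≤ ∑ n ∈ Finset.Icc 1 ⌊Real.exp t⌋₊, d n / Real.sqrt n * (t - Real.log n) := by
  refine Finset.sum_nonneg fun n hn ↦ mul_nonneg (div_nonneg (hd0 n) (Real.sqrt_nonneg _)) ?_
  rw [Finset.mem_Icc] at hn
  have hn0 : (0 : ℝ) < n := by exact_mod_cast hn.1
  have hle : Real.log n ≤ t := by
    rw [Real.log_le_iff_le_exp hn0]
    exact le_trans (by exact_mod_cast hn.2) (Nat.floor_le (Real.exp_pos t).le)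
  linarith

/-- `A_d(t) = Σ_{n ≥ 0} d(n) n^{-1/2} 𝟙[log n ≤ t]` (a finitely supported sum). [folklore] -/
private theorem hasSum_countTerm (d : ℕ → ℝ) (t : ℝ) :
    HasSum (fun n : ℕ ↦ d n / Real.sqrt n * (if Real.log n ≤ t then (1 : ℝ) else 0))
      (∑ n ∈ Finset.Icc 1 ⌊Real.exp t⌋₊, d n / Real.sqrt n) := by
  have hS : ∑ n ∈ Finset.Icc 1 ⌊Real.exp t⌋₊, d n / Real.sqrt n * (if Real.log n ≤ t then (1 : ℝ) else 0)
      = ∑ n ∈ Finset.Icc 1 ⌊Real.exp t⌋₊, d n / Real.sqrt n := by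
    refine Finset.sum_congr rfl fun n hn ↦ ?_
    rw [Finset.mem_Icc] at hn
    have hn0 : (0 : ℝ) < n := by exact_mod_cast hn.1
    have hle : Real.log n ≤ t := by
      rw [Real.log_le_iff_le_exp hn0]
      exact le_trans (by exact_mod_cast hn.2) (Nat.floor_le (Real.exp_pos t).le)
    rw [if_pos hle, mul_one]
  rw [← hS]
  refine hasSum_sum_of_ne_finset_zero fun n hn ↦ ?_
  rw [Finset.mem_Icc, not_and_or, not_le, not_le] at hn
  rcases hn with hn | hn
  · have : n = 0 := by omega
    subst this
    simp
  · have hn0 : (0 : ℝ) < n := by exact_mod_cast lt_of_le_of_lt (Nat.zero_le _) hn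
    have hlt : t < Real.log n := by
      rw [Real.lt_log_iff_exp_lt hn0]
      exact Nat.lt_of_floor_lt hn
    rw [if_neg (not_le.2 hlt), mul_zero]

/-- `φ_d(t) = Σ_{n ≥ 0} d(n) n^{-1/2} (t − log n)₊` (a finitely supported sum). [folklore] -/
private theorem hasSum_weightedTerm (d : ℕ → ℝ) (t : ℝ) :
    HasSum (fun n : ℕ ↦ d n / Real.sqrt n * max (t - Real.log n) 0)
      (∑ n ∈ Finset.Icc 1 ⌊Real.exp t⌋₊, d n / Real.sqrt n * (t - Real.log n)) := by
  have hS : ∑ n ∈ Finset.Icc 1 ⌊Real.exp t⌋₊, d n / Real.sqrt n * max (t - Real.log n) 0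
      = ∑ n ∈ Finset.Icc 1 ⌊Real.exp t⌋₊, d n / Real.sqrt n * (t - Real.log n) := by
    refine Finset.sum_congr rfl fun n hn ↦ ?_
    rw [Finset.mem_Icc] at hn
    have hn0 : (0 : ℝ) < n := by exact_mod_cast hn.1
    have hle : Real.log n ≤ t := by
      rw [Real.log_le_iff_le_exp hn0]
      exact le_trans (by exact_mod_cast hn.2) (Nat.floor_le (Real.exp_pos t).le)
    rw [max_eq_left (sub_nonneg.2 hle)]
  rw [← hS]
  refine hasSum_sum_of_ne_finset_zero fun n hn ↦ ?_
  rw [Finset.mem_Icc, not_and_or, not_le, not_le] at hn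
  rcases hn with hn | hn
  · have : n = 0 := by omega
    subst this
    simp
  · have hn0 : (0 : ℝ) < n := by exact_mod_cast lt_of_le_of_lt (Nat.zero_le _) hn
    have hlt : t < Real.log n := by
      rw [Real.lt_log_iff_exp_lt hn0]
      exact Nat.lt_of_floor_lt hn
    rw [max_eq_right (by linarith), mul_zero]

/-! ### Laplace transforms of the indicator kernels `𝟙[ℓ ≤ t]` -/

/-- `𝟙[ℓ ≤ t] e^{at}` is integrable on `(0, ∞)` for `Re a < 0`. [folklore] -/
private theorem integrableOn_indicator_mul_cexp (ℓ : ℝ) (ha : a.re < 0) :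
    IntegrableOn (fun t : ℝ ↦ ((if ℓ ≤ t then (1 : ℝ) else 0 : ℝ) : ℂ) * cexp (a * t)) (Ioi 0) := by
  refine Integrable.mono (integrableOn_exp_mul_complex_Ioi ha 0) ?_ ?_
  · refine AEStronglyMeasurable.mul ?_ (by fun_prop)
    refine (Complex.measurable_ofReal.comp ?_).aestronglyMeasurable
    exact Measurable.ite measurableSet_Ici measurable_const measurable_const
  · refine (ae_restrict_mem measurableSet_Ioi).mono fun t _ ↦ ?_
    by_cases h : ℓ ≤ t
    · simp [h]
    · simp [h]

/-- `∫_0^∞ 𝟙[ℓ ≤ t] e^{at} dt = −e^{aℓ}/a` for `ℓ ≥ 0`, `Re a < 0`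
(`∫_0^∞ 𝟙[log n ≤ t] e^{−St} dt = n^{−S}/S`, §3.3). [cite: Suzuki2025Chebyshev, §3.3] -/
private theorem integral_indicator_mul_cexp {ℓ : ℝ} (hℓ : 0 ≤ ℓ) (ha : a.re < 0) :
    ∫ t in Ioi (0 : ℝ), ((if ℓ ≤ t then (1 : ℝ) else 0 : ℝ) : ℂ) * cexp (a * t) =
      -cexp (a * ℓ) / a := by
  have h1 : (fun t : ℝ ↦ ((if ℓ ≤ t then (1 : ℝ) else 0 : ℝ) : ℂ) * cexp (a * t)) =
      (Ici ℓ).indicator (fun t : ℝ ↦ cexp (a * t)) := by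
    funext t
    by_cases h : ℓ ≤ t
    · rw [if_pos h, indicator_of_mem (mem_Ici.2 h), Complex.ofReal_one, one_mul]
    · rw [if_neg h, indicator_of_notMem (fun h' ↦ h (mem_Ici.1 h')), Complex.ofReal_zero, zero_mul]
  rw [h1, setIntegral_indicator measurableSet_Ici]
  rcases hℓ.eq_or_lt with h0 | hpos
  · rw [← h0, Set.inter_eq_left.2 Ioi_subset_Ici_self, integral_exp_mul_complex_Ioi ha 0]
  · rw [Set.inter_eq_right.2 (Ici_subset_Ioi.2 hpos), integral_Ici_eq_integral_Ioi,
      integral_exp_mul_complex_Ioi ha ℓ]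

/-- Real form: `∫_0^∞ 𝟙[ℓ ≤ t] e^{rt} dt = −e^{rℓ}/r` (`ℓ ≥ 0`, `r < 0`). [folklore] -/
private theorem integral_indicator_mul_exp {ℓ r : ℝ} (hℓ : 0 ≤ ℓ) (hr : r < 0) :
    ∫ t in Ioi (0 : ℝ), (if ℓ ≤ t then (1 : ℝ) else 0) * Real.exp (r * t) =
      -Real.exp (r * ℓ) / r := by
  have h1 : (fun t : ℝ ↦ (if ℓ ≤ t then (1 : ℝ) else 0) * Real.exp (r * t)) =
      (Ici ℓ).indicator (fun t : ℝ ↦ Real.exp (r * t)) := by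
    funext t
    by_cases h : ℓ ≤ t
    · rw [if_pos h, indicator_of_mem (mem_Ici.2 h), one_mul]
    · rw [if_neg h, indicator_of_notMem (fun h' ↦ h (mem_Ici.1 h')), zero_mul]
  rw [h1, setIntegral_indicator measurableSet_Ici]
  rcases hℓ.eq_or_lt with h0 | hpos
  · rw [← h0, Set.inter_eq_left.2 Ioi_subset_Ici_self, integral_exp_mul_Ioi hr 0]
  · rw [Set.inter_eq_right.2 (Ici_subset_Ioi.2 hpos), integral_Ici_eq_integral_Ioi,
      integral_exp_mul_Ioi hr ℓ]

/-! ### Termwise algebra: the transforms are `L`-series terms of the coefficient `d` -/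

/-- `d(n) n^{-1/2} · (−n^{a}/a) = −a^{-1} d(n)/n^{1/2 − a}`. [folklore] -/
private theorem countTerm_integral_eq_term {n : ℕ} (d : ℕ → ℝ) (a : ℂ) (ha0 : a ≠ 0) :
    ((d n / Real.sqrt n : ℝ) : ℂ) * (-cexp (a * (Real.log n : ℝ)) / a) =
      -(1 / a) * LSeries.term (fun n ↦ (d n : ℂ)) (1 / 2 - a) n := by
  rcases eq_or_ne n 0 with rfl | hn
  · simp
  have hsqrt : (Real.sqrt n : ℂ) ≠ 0 :=
    ofReal_ne_zero.2 (Real.sqrt_ne_zero'.2 (by exact_mod_cast Nat.pos_of_ne_zero hn))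
  have hna : (n : ℂ) ^ a ≠ 0 := cpow_ne_zero_iff.2 (Or.inl (Nat.cast_ne_zero.2 hn))
  rw [LSeries.term_of_ne_zero hn, ZetaScrewLaplace.natCast_cpow_half_sub hn,
    ZetaScrewLaplace.cexp_mul_log_natCast hn]
  push_cast
  field_simp

/-- `d(n) n^{-1/2} · n^{a}/a² = a^{-2} d(n)/n^{1/2 − a}`. [folklore] -/
private theorem weightedTerm_integral_eq_term {n : ℕ} (d : ℕ → ℝ) (a : ℂ) (ha0 : a ≠ 0) :
    ((d n / Real.sqrt n : ℝ) : ℂ) * (cexp (a * (Real.log n : ℝ)) / a ^ 2) =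
      1 / a ^ 2 * LSeries.term (fun n ↦ (d n : ℂ)) (1 / 2 - a) n := by
  rcases eq_or_ne n 0 with rfl | hn
  · simp
  have hsqrt : (Real.sqrt n : ℂ) ≠ 0 :=
    ofReal_ne_zero.2 (Real.sqrt_ne_zero'.2 (by exact_mod_cast Nat.pos_of_ne_zero hn))
  have hna : (n : ℂ) ^ a ≠ 0 := cpow_ne_zero_iff.2 (Or.inl (Nat.cast_ne_zero.2 hn))
  rw [LSeries.term_of_ne_zero hn, ZetaScrewLaplace.natCast_cpow_half_sub hn,
    ZetaScrewLaplace.cexp_mul_log_natCast hn]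
  push_cast
  field_simp

/-- `d(n) n^{-1/2} e^{r log n} = ‖d(n) n^{-(1/2 − a)}‖` (`r = Re a`, `d ≥ 0`). [folklore] -/
private theorem countTerm_norm_eq {n : ℕ} (hd0 : ∀ n, 0 ≤ d n) (a : ℂ) :
    d n / Real.sqrt n * Real.exp (a.re * Real.log n) =
      ‖LSeries.term (fun n ↦ (d n : ℂ)) (1 / 2 - a) n‖ := by
  rcases eq_or_ne n 0 with rfl | hn
  · simp
  have hn0 : (0 : ℝ) < n := by exact_mod_cast Nat.pos_of_ne_zero hn
  rw [LSeries.norm_term_eq, if_neg hn, Complex.norm_real, Real.norm_eq_abs, abs_of_nonneg (hd0 n)]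
  have hre : (1 / 2 - a).re = 1 / 2 - a.re := by simp
  rw [hre, Real.rpow_sub hn0, ← Real.sqrt_eq_rpow, mul_comm (a.re) (Real.log n),
    ← Real.rpow_def_of_pos hn0]
  have hsqrt : Real.sqrt n ≠ 0 := Real.sqrt_ne_zero'.2 hn0
  have hpow : (n : ℝ) ^ a.re ≠ 0 := (Real.rpow_pos_of_pos hn0 _).ne'
  field_simp

/-- `d(n) n^{-1/2} e^{r log n}/r² = r^{-2} ‖d(n) n^{-(1/2 − a)}‖` (`r = Re a ≠ 0`, `d ≥ 0`). [folklore] -/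
private theorem weightedTerm_norm_integral_eq {n : ℕ} (hd0 : ∀ n, 0 ≤ d n) (a : ℂ) (ha : a.re ≠ 0) :
    d n / Real.sqrt n * (Real.exp (a.re * Real.log n) / a.re ^ 2) =
      1 / a.re ^ 2 * ‖LSeries.term (fun n ↦ (d n : ℂ)) (1 / 2 - a) n‖ := by
  rw [← countTerm_norm_eq hd0 a]
  field_simp

/-- For `0 ≤ d ≤ Λ` and `Re s > 1`: `Σ_n ‖d(n) n^{-s}‖ < ∞` (dominated by `L(Λ, Re s)`). [folklore] -/
private theorem summable_norm_term (hd0 : ∀ n, 0 ≤ d n) (hdle : ∀ n, d n ≤ Λ n) {s : ℂ} (hs : 1 < s.re) :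
    Summable fun n ↦ ‖LSeries.term (fun n ↦ (d n : ℂ)) s n‖ := by
  refine (LSeriesSummable_vonMangoldt hs).norm.of_nonneg_of_le (fun _ ↦ norm_nonneg _) fun n ↦ ?_
  refine LSeries.norm_term_le s ?_
  rw [Complex.norm_real, Complex.norm_real, Real.norm_of_nonneg (hd0 n),
    Real.norm_of_nonneg vonMangoldt_nonneg]
  exact hdle n

/-- For `0 ≤ d ≤ Λ` and `Re s > 1`: `L(d, s)` converges absolutely. [folklore] -/
private theorem lseriesSummable (hd0 : ∀ n, 0 ≤ d n) (hdle : ∀ n, d n ≤ Λ n) {s : ℂ} (hs : 1 < s.re) :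
    LSeriesSummable (fun n ↦ (d n : ℂ)) s :=
  (summable_norm_term hd0 hdle hs).of_norm

/-! ### The Laplace transforms of `A_d` and `φ_d` -/

/-- **Laplace transform of `A_d`**: for `0 ≤ d ≤ Λ` and `Re a < −1/2`, `t ↦ A_d(t) e^{at}` is integrable on `(0, ∞)`
and `∫₀^∞ A_d(t) e^{at} dt = −a^{-1} Σ_n d(n) n^{-(1/2-a)}` (termwise; the interchange by absolute convergence).
[cite: Suzuki2025Chebyshev, §3.3 (first display) and §4.2–4.3] -/
theorem integral_count_mul_cexp (hd0 : ∀ n, 0 ≤ d n) (hdle : ∀ n, d n ≤ Λ n) (ha : a.re < -1 / 2) :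
    IntegrableOn (fun t : ℝ ↦
        ((∑ n ∈ Finset.Icc 1 ⌊Real.exp t⌋₊, d n / Real.sqrt n : ℝ) : ℂ) * cexp (a * t)) (Ioi 0) ∧
      ∫ t in Ioi (0 : ℝ),
          ((∑ n ∈ Finset.Icc 1 ⌊Real.exp t⌋₊, d n / Real.sqrt n : ℝ) : ℂ) * cexp (a * t) =
        -(1 / a) * L (fun n ↦ (d n : ℂ)) (1 / 2 - a) := by
  have ha' : a.re < 0 := by linarith
  have ha0 : a ≠ 0 := fun h ↦ by rw [h] at ha'; simp at ha'
  have hre0 : a.re ≠ 0 := ha'.ne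
  have hs : 1 < (1 / 2 - a).re := by simp; linarith
  set μ : Measure ℝ := volume.restrict (Ioi 0) with hμ
  set Pc : ℝ → ℝ := fun t ↦ ∑ n ∈ Finset.Icc 1 ⌊Real.exp t⌋₊, d n / Real.sqrt n with hPc
  -- the terms
  set F : ℕ → ℝ → ℂ := fun n t ↦
    ((d n / Real.sqrt n : ℝ) : ℂ) *
      ((((if Real.log n ≤ t then (1 : ℝ) else 0 : ℝ)) : ℂ) * cexp (a * t)) with hF
  have hlog : ∀ n : ℕ, 0 ≤ Real.log n := fun n ↦ Real.log_natCast_nonneg n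
  have hF_int : ∀ n, Integrable (F n) μ := fun n ↦
    (integrableOn_indicator_mul_cexp (Real.log n) ha').const_mul _
  -- their integrals
  have hF_val : ∀ n, ∫ t, F n t ∂μ = -(1 / a) * LSeries.term (fun n ↦ (d n : ℂ)) (1 / 2 - a) n := by
    intro n
    simp only [hF, hμ]
    rw [integral_const_mul, integral_indicator_mul_cexp (hlog n) ha', countTerm_integral_eq_term d a ha0]
  -- their `L¹` norms
  have hF_norm : ∀ n, ∫ t, ‖F n t‖ ∂μ =
      1 / (-a.re) * ‖LSeries.term (fun n ↦ (d n : ℂ)) (1 / 2 - a) n‖ := by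
    intro n
    have hpt : ∀ t ∈ Ioi (0 : ℝ), ‖F n t‖ =
        d n / Real.sqrt n * ((if Real.log n ≤ t then (1 : ℝ) else 0) * Real.exp (a.re * t)) := by
      intro t _
      simp only [hF, norm_mul, Complex.norm_real, Real.norm_eq_abs,
        ZetaScrewLaplace.norm_cexp_mul_ofReal,
        abs_of_nonneg (div_nonneg (hd0 n) (Real.sqrt_nonneg _))]
      by_cases h : Real.log n ≤ t
      · rw [if_pos h, abs_one]
      · rw [if_neg h, abs_zero]
    simp only [hμ]
    rw [setIntegral_congr_fun measurableSet_Ioi hpt, integral_const_mul,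
      integral_indicator_mul_exp (hlog n) ha', ← countTerm_norm_eq hd0 a]
    field_simp
  have hF_sum : Summable fun n ↦ ∫ t, ‖F n t‖ ∂μ := by
    simp_rw [hF_norm]
    exact (summable_norm_term hd0 hdle hs).mul_left _
  -- pointwise sums on `(0, ∞)`
  have hpt : ∀ t ∈ Ioi (0 : ℝ), HasSum (fun n ↦ F n t) ((Pc t : ℂ) * cexp (a * t)) := by
    intro t _
    have h := (Complex.hasSum_ofReal.2 (hasSum_countTerm d t)).mul_right (cexp (a * t))
    refine h.congr_fun fun n ↦ ?_
    simp only [hF]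
    push_cast
    ring
  have hpt_norm : ∀ t ∈ Ioi (0 : ℝ),
      HasSum (fun n ↦ ‖F n t‖) ‖(Pc t : ℂ) * cexp (a * t)‖ := by
    intro t _
    have h := (hasSum_countTerm d t).mul_right (Real.exp (a.re * t))
    rw [norm_mul, Complex.norm_real, Real.norm_eq_abs, abs_of_nonneg (count_nonneg hd0 t),
      ZetaScrewLaplace.norm_cexp_mul_ofReal]
    refine h.congr_fun fun n ↦ ?_
    simp only [hF, norm_mul, Complex.norm_real, Real.norm_eq_abs,
      ZetaScrewLaplace.norm_cexp_mul_ofReal,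
      abs_of_nonneg (div_nonneg (hd0 n) (Real.sqrt_nonneg _))]
    by_cases h' : Real.log n ≤ t
    · rw [if_pos h', abs_one]; ring
    · rw [if_neg h', abs_zero]; ring
  -- integrability of `A_d e^{at}`
  have hmeas : AEStronglyMeasurable (fun t : ℝ ↦ (Pc t : ℂ) * cexp (a * t)) μ :=
    ((Complex.measurable_ofReal.comp (measurable_count hd0)).mul
      (by fun_prop : Continuous fun t : ℝ ↦ cexp (a * t)).measurable).aestronglyMeasurable
  have hint : IntegrableOn (fun t : ℝ ↦ (Pc t : ℂ) * cexp (a * t)) (Ioi 0) := by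
    refine ZetaScrewLaplace.integrable_of_hasSum_norm (μ := μ) hmeas hF_int hF_sum ?_
    exact (ae_restrict_mem measurableSet_Ioi).mono hpt_norm
  refine ⟨hint, ?_⟩
  -- interchange of sum and integral
  have hsum := hasSum_integral_of_summable_integral_norm hF_int hF_sum
  have heq : ∫ t, (∑' n, F n t) ∂μ = ∫ t in Ioi (0 : ℝ), (Pc t : ℂ) * cexp (a * t) := by
    simp only [hμ]
    exact setIntegral_congr_fun measurableSet_Ioi fun t ht ↦ (hpt t ht).tsum_eq
  rw [heq] at hsum
  simp_rw [hF_val] at hsum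
  have hL : HasSum (fun n ↦ -(1 / a) * LSeries.term (fun n ↦ (d n : ℂ)) (1 / 2 - a) n)
      (-(1 / a) * L (fun n ↦ (d n : ℂ)) (1 / 2 - a)) :=
    (lseriesSummable hd0 hdle hs).hasSum.mul_left _
  exact hsum.unique hL

/-- **Laplace transform of `φ_d`**: for `0 ≤ d ≤ Λ` and `Re a < −1/2`, `t ↦ φ_d(t) e^{at}` is integrable on `(0, ∞)`
and `∫₀^∞ φ_d(t) e^{at} dt = a^{-2} Σ_n d(n) n^{-(1/2-a)}` (termwise `∫₀^∞ (t − log n)₊ e^{at} dt = n^{a}/a²`).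
[cite: Suzuki2025Chebyshev, §3.1 (the display before (3.3)) and §4.2–4.3] -/
theorem integral_weighted_mul_cexp (hd0 : ∀ n, 0 ≤ d n) (hdle : ∀ n, d n ≤ Λ n) (ha : a.re < -1 / 2) :
    IntegrableOn (fun t : ℝ ↦
        ((∑ n ∈ Finset.Icc 1 ⌊Real.exp t⌋₊, d n / Real.sqrt n * (t - Real.log n) : ℝ) : ℂ) *
          cexp (a * t)) (Ioi 0) ∧
      ∫ t in Ioi (0 : ℝ),
          ((∑ n ∈ Finset.Icc 1 ⌊Real.exp t⌋₊, d n / Real.sqrt n * (t - Real.log n) : ℝ) : ℂ) *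
            cexp (a * t) =
        1 / a ^ 2 * L (fun n ↦ (d n : ℂ)) (1 / 2 - a) := by
  have ha' : a.re < 0 := by linarith
  have ha0 : a ≠ 0 := fun h ↦ by rw [h] at ha'; simp at ha'
  have hre0 : a.re ≠ 0 := ha'.ne
  have hs : 1 < (1 / 2 - a).re := by simp; linarith
  set μ : Measure ℝ := volume.restrict (Ioi 0) with hμ
  set Φ : ℝ → ℝ := fun t ↦ ∑ n ∈ Finset.Icc 1 ⌊Real.exp t⌋₊, d n / Real.sqrt n * (t - Real.log n) with hΦ
  -- the terms
  set F : ℕ → ℝ → ℂ := fun n t ↦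
    ((d n / Real.sqrt n : ℝ) : ℂ) * (((max (t - Real.log n) 0 : ℝ) : ℂ) * cexp (a * t)) with hF
  have hlog : ∀ n : ℕ, 0 ≤ Real.log n := fun n ↦ Real.log_natCast_nonneg n
  have hF_int : ∀ n, Integrable (F n) μ := fun n ↦
    (ZetaScrewLaplace.integrableOn_max_sub_mul_cexp (hlog n) ha').const_mul _
  -- their integrals
  have hF_val : ∀ n, ∫ t, F n t ∂μ = 1 / a ^ 2 * LSeries.term (fun n ↦ (d n : ℂ)) (1 / 2 - a) n := by
    intro n
    simp only [hF, hμ]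
    rw [integral_const_mul, ZetaScrewLaplace.integral_max_sub_mul_cexp (hlog n) ha',
      weightedTerm_integral_eq_term d a ha0]
  -- their `L¹` norms
  have hF_norm : ∀ n, ∫ t, ‖F n t‖ ∂μ =
      1 / a.re ^ 2 * ‖LSeries.term (fun n ↦ (d n : ℂ)) (1 / 2 - a) n‖ := by
    intro n
    have hpt : ∀ t ∈ Ioi (0 : ℝ), ‖F n t‖ =
        d n / Real.sqrt n * (max (t - Real.log n) 0 * Real.exp (a.re * t)) := by
      intro t _
      simp only [hF, norm_mul, Complex.norm_real, Real.norm_eq_abs, ZetaScrewLaplace.norm_cexp_mul_ofReal,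
        abs_of_nonneg (div_nonneg (hd0 n) (Real.sqrt_nonneg _)),
        abs_of_nonneg (le_max_right (t - Real.log n) 0)]
    simp only [hμ]
    rw [setIntegral_congr_fun measurableSet_Ioi hpt, integral_const_mul,
      ZetaScrewLaplace.integral_max_sub_mul_exp (hlog n) ha', weightedTerm_norm_integral_eq hd0 a hre0]
  have hF_sum : Summable fun n ↦ ∫ t, ‖F n t‖ ∂μ := by
    simp_rw [hF_norm]
    exact (summable_norm_term hd0 hdle hs).mul_left _
  -- pointwise sums on `(0, ∞)`
  have hpt : ∀ t ∈ Ioi (0 : ℝ), HasSum (fun n ↦ F n t) ((Φ t : ℂ) * cexp (a * t)) := by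
    intro t _
    have h := (Complex.hasSum_ofReal.2 (hasSum_weightedTerm d t)).mul_right (cexp (a * t))
    refine h.congr_fun fun n ↦ ?_
    simp only [hF]
    push_cast
    ring
  have hpt_norm : ∀ t ∈ Ioi (0 : ℝ),
      HasSum (fun n ↦ ‖F n t‖) ‖(Φ t : ℂ) * cexp (a * t)‖ := by
    intro t _
    have h := (hasSum_weightedTerm d t).mul_right (Real.exp (a.re * t))
    rw [norm_mul, Complex.norm_real, Real.norm_eq_abs, abs_of_nonneg (weighted_nonneg hd0 t),
      ZetaScrewLaplace.norm_cexp_mul_ofReal]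
    refine h.congr_fun fun n ↦ ?_
    simp only [hF, norm_mul, Complex.norm_real, Real.norm_eq_abs, ZetaScrewLaplace.norm_cexp_mul_ofReal,
      abs_of_nonneg (div_nonneg (hd0 n) (Real.sqrt_nonneg _)),
      abs_of_nonneg (le_max_right (t - Real.log n) 0)]
    ring
  -- integrability of `φ_d e^{at}`
  have hmeas : AEStronglyMeasurable (fun t : ℝ ↦ (Φ t : ℂ) * cexp (a * t)) μ :=
    ((Complex.measurable_ofReal.comp (measurable_weighted hd0)).mul
      (by fun_prop : Continuous fun t : ℝ ↦ cexp (a * t)).measurable).aestronglyMeasurable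
  have hint : IntegrableOn (fun t : ℝ ↦ (Φ t : ℂ) * cexp (a * t)) (Ioi 0) := by
    refine ZetaScrewLaplace.integrable_of_hasSum_norm (μ := μ) hmeas hF_int hF_sum ?_
    exact (ae_restrict_mem measurableSet_Ioi).mono hpt_norm
  refine ⟨hint, ?_⟩
  -- interchange of sum and integral
  have hsum := hasSum_integral_of_summable_integral_norm hF_int hF_sum
  have heq : ∫ t, (∑' n, F n t) ∂μ = ∫ t in Ioi (0 : ℝ), (Φ t : ℂ) * cexp (a * t) := by
    simp only [hμ]
    exact setIntegral_congr_fun measurableSet_Ioi fun t ht ↦ (hpt t ht).tsum_eq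
  rw [heq] at hsum
  simp_rw [hF_val] at hsum
  have hL : HasSum (fun n ↦ 1 / a ^ 2 * LSeries.term (fun n ↦ (d n : ℂ)) (1 / 2 - a) n)
      (1 / a ^ 2 * L (fun n ↦ (d n : ℂ)) (1 / 2 - a)) :=
    (lseriesSummable hd0 hdle hs).hasSum.mul_left _
  exact hsum.unique hL

/-- **The transform of `G_d = 2A_d − φ_d` in the Landau variable**: for `0 ≤ d ≤ Λ` and `Re S > 1`,
`t ↦ G_d(t) e^{−St}` is integrable on `(0, ∞)` and `∫₀^∞ (2A_d(t) − φ_d(t)) e^{−St} dt = (2S − 1) S^{−2} L(d, ½ + S)`.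
[cite: Suzuki2025Chebyshev, §3.3 eq. (3.6) (with `Λ` replaced by `d`) and §4.3] -/
theorem laplace_two_count_sub_weighted (hd0 : ∀ n, 0 ≤ d n) (hdle : ∀ n, d n ≤ Λ n) {s : ℂ} (hs : 1 / 2 < s.re) :
    IntegrableOn (fun t : ℝ ↦
        ((2 * (∑ n ∈ Finset.Icc 1 ⌊Real.exp t⌋₊, d n / Real.sqrt n)
            - ∑ n ∈ Finset.Icc 1 ⌊Real.exp t⌋₊, d n / Real.sqrt n * (t - Real.log n) : ℝ) : ℂ) *
          cexp (-s * t)) (Ioi 0) ∧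
      ∫ t in Ioi (0 : ℝ),
          ((2 * (∑ n ∈ Finset.Icc 1 ⌊Real.exp t⌋₊, d n / Real.sqrt n)
              - ∑ n ∈ Finset.Icc 1 ⌊Real.exp t⌋₊, d n / Real.sqrt n * (t - Real.log n) : ℝ) : ℂ) *
            cexp (-s * t) =
        (2 * s - 1) / s ^ 2 * L (fun n ↦ (d n : ℂ)) (1 / 2 + s) := by
  have ha : (-s).re < -1 / 2 := by simp; linarith
  obtain ⟨hi₁, hI₁⟩ := integral_count_mul_cexp hd0 hdle ha
  obtain ⟨hi₂, hI₂⟩ := integral_weighted_mul_cexp hd0 hdle ha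
  set f₁ : ℝ → ℂ := fun t ↦
    ((∑ n ∈ Finset.Icc 1 ⌊Real.exp t⌋₊, d n / Real.sqrt n : ℝ) : ℂ) * cexp (-s * t) with hf₁
  set f₂ : ℝ → ℂ := fun t ↦
    ((∑ n ∈ Finset.Icc 1 ⌊Real.exp t⌋₊, d n / Real.sqrt n * (t - Real.log n) : ℝ) : ℂ) * cexp (-s * t)
    with hf₂
  have heq : EqOn (fun t : ℝ ↦
      ((2 * (∑ n ∈ Finset.Icc 1 ⌊Real.exp t⌋₊, d n / Real.sqrt n)
          - ∑ n ∈ Finset.Icc 1 ⌊Real.exp t⌋₊, d n / Real.sqrt n * (t - Real.log n) : ℝ) : ℂ) *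
        cexp (-s * t)) (fun t ↦ 2 * f₁ t - f₂ t) (Ioi 0) := by
    intro t _
    simp only [hf₁, hf₂]
    push_cast
    ring
  have hi : IntegrableOn (fun t ↦ 2 * f₁ t - f₂ t) (Ioi 0) := (hi₁.const_mul 2).sub hi₂
  refine ⟨hi.congr_fun heq.symm measurableSet_Ioi, ?_⟩
  rw [setIntegral_congr_fun measurableSet_Ioi heq, integral_sub (hi₁.const_mul 2) hi₂,
    integral_const_mul, hI₁, hI₂, show (1 / 2 : ℂ) - -s = 1 / 2 + s by ring]
  have hs0 : s ≠ 0 := fun h ↦ by rw [h, zero_re] at hs; linarith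
  field_simp

/-! ### The higher prime powers: `L(Λ·𝟙_{not prime}, w)` converges absolutely on `Re w > 1/2` -/

/-- **`Σ_{n = p^k, k ≥ 2} Λ(n) n^{-y} < ∞` for real `y > 1/2`** (the printed «converge absolutely … in `Re(s) > 1/2`» of
(4.11)): re-indexed by the injective map `(p, k) ↦ p^{k+2}` it is `Σ_p log p · p^{-2y} Σ_{k ≥ 0} (p^{-y})^k`, and
`Σ_{k ≥ 0} (p^{-y})^k ≤ 4`, `log p ≤ p^δ/δ` (`δ = y − ½`), `Σ_p p^{-(y + 1/2)} < ∞`. [cite: Suzuki2025Chebyshev, §4.2 eq. (4.11)] -/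
theorem summable_vonMangoldt_nonPrime_mul_rpow {y : ℝ} (hy : 1 / 2 < y) :
    Summable fun n : ℕ ↦ (if n.Prime then 0 else Λ n) * (n : ℝ) ^ (-y) := by
  set F : ℕ → ℝ := fun n ↦ (if n.Prime then 0 else Λ n) * (n : ℝ) ^ (-y) with hF
  set g : Nat.Primes × ℕ → ℕ := fun pk ↦ (pk.1 : ℕ) ^ (pk.2 + 2) with hg
  have hginj : Function.Injective g := by
    rintro ⟨p₁, k₁⟩ ⟨p₂, k₂⟩ h
    obtain ⟨h1, h2⟩ := Nat.Prime.pow_inj' p₁.prop p₂.prop (by omega) (by omega) h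
    have hp : p₁ = p₂ := Subtype.ext h1
    subst hp
    have hk : k₁ = k₂ := by omega
    subst hk
    rfl
  have hzero : ∀ n ∉ Set.range g, F n = 0 := by
    intro n hn
    simp only [hF]
    by_cases hp : n.Prime
    · simp [hp]
    rw [if_neg hp]
    by_cases hΛ : Λ n = 0
    · simp [hΛ]
    exfalso
    obtain ⟨p, k, hpp, hk, rfl⟩ := (isPrimePow_nat_iff _).1 (vonMangoldt_ne_zero_iff.1 hΛ)
    rcases Nat.lt_or_ge k 2 with hk2 | hk2
    · have hk1 : k = 1 := by omega
      subst hk1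
      exact hp (by simpa using hpp)
    · refine hn ⟨(⟨p, hpp⟩, k - 2), ?_⟩
      simp only [hg]
      rw [Nat.sub_add_cancel hk2]
  refine (hginj.summable_iff hzero).1 ?_
  have hδ : 0 < y - 1 / 2 := by linarith
  -- the re-indexed terms
  have hFg : ∀ pk : Nat.Primes × ℕ, (F ∘ g) pk =
      Real.log ((pk.1 : ℕ) : ℝ) * ((pk.1 : ℕ) : ℝ) ^ (-(2 * y)) * ((((pk.1 : ℕ) : ℝ) ^ (-y)) ^ pk.2) := by
    rintro ⟨p, k⟩
    have hp0 : (0 : ℝ) < ((p : ℕ) : ℝ) := by exact_mod_cast p.prop.pos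
    simp only [Function.comp_apply, hF, hg]
    rw [if_neg (Nat.Prime.not_prime_pow (by omega)), vonMangoldt_apply_pow (by omega),
      vonMangoldt_apply_prime p.prop]
    push_cast
    rw [← Real.rpow_natCast (((p : ℕ) : ℝ) ^ (-y)) k, ← Real.rpow_mul hp0.le,
      ← Real.rpow_natCast ((p : ℕ) : ℝ) (k + 2), ← Real.rpow_mul hp0.le, mul_assoc, ← Real.rpow_add hp0]
    congr 2
    push_cast
    ring
  have hFg' : (F ∘ g) = fun pk : Nat.Primes × ℕ ↦
      Real.log ((pk.1 : ℕ) : ℝ) * ((pk.1 : ℕ) : ℝ) ^ (-(2 * y)) * ((((pk.1 : ℕ) : ℝ) ^ (-y)) ^ pk.2) :=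
    funext hFg
  rw [hFg']
  -- ratio of the geometric series
  have hr0 : ∀ p : Nat.Primes, 0 ≤ ((p : ℕ) : ℝ) ^ (-y) := fun p ↦ Real.rpow_nonneg (Nat.cast_nonneg _) _
  have hr1 : ∀ p : Nat.Primes, ((p : ℕ) : ℝ) ^ (-y) ≤ 3 / 4 := by
    intro p
    have hp2 : (2 : ℝ) ≤ ((p : ℕ) : ℝ) := by exact_mod_cast p.prop.two_le
    have hp0 : (0 : ℝ) < ((p : ℕ) : ℝ) := by linarith
    have h1 : ((p : ℕ) : ℝ) ^ (-y) ≤ ((p : ℕ) : ℝ) ^ (-(1 / 2 : ℝ)) :=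
      Real.rpow_le_rpow_of_exponent_le (by linarith) (by linarith)
    have h2 : ((p : ℕ) : ℝ) ^ (-(1 / 2 : ℝ)) ≤ (2 : ℝ) ^ (-(1 / 2 : ℝ)) :=
      Real.rpow_le_rpow_of_nonpos (by norm_num) hp2 (by norm_num)
    have h3 : (2 : ℝ) ^ (-(1 / 2 : ℝ)) ≤ 3 / 4 := by
      rw [Real.rpow_neg (by norm_num : (0 : ℝ) ≤ 2), ← Real.sqrt_eq_rpow]
      have hs : (4 : ℝ) / 3 ≤ Real.sqrt 2 := by
        rw [Real.le_sqrt (by norm_num) (by norm_num)]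
        norm_num
      have hs0 : 0 < Real.sqrt 2 := by positivity
      rw [inv_le_comm₀ hs0 (by norm_num)]
      linarith
    linarith
  have hlog0 : ∀ p : Nat.Primes, 0 ≤ Real.log ((p : ℕ) : ℝ) := fun p ↦ Real.log_natCast_nonneg _
  refine (summable_prod_of_nonneg fun pk ↦ ?_).2 ⟨fun p ↦ ?_, ?_⟩
  · exact mul_nonneg (mul_nonneg (hlog0 _) (Real.rpow_nonneg (Nat.cast_nonneg _) _)) (pow_nonneg (hr0 _) _)
  · dsimp only
    exact (summable_geometric_of_lt_one (hr0 p) (by linarith [hr1 p])).mul_left _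
  · -- `Σ_k … = log p · p^{-2y} · (1 − p^{-y})⁻¹ ≤ (4/δ) p^{-(y + 1/2)}`
    have hval : ∀ p : Nat.Primes, ∑' k : ℕ,
        Real.log ((p : ℕ) : ℝ) * ((p : ℕ) : ℝ) ^ (-(2 * y)) * ((((p : ℕ) : ℝ) ^ (-y)) ^ k) =
          Real.log ((p : ℕ) : ℝ) * ((p : ℕ) : ℝ) ^ (-(2 * y)) * (1 - ((p : ℕ) : ℝ) ^ (-y))⁻¹ := by
      intro p
      rw [tsum_mul_left, tsum_geometric_of_lt_one (hr0 p) (by linarith [hr1 p])]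
    dsimp only
    simp_rw [hval]
    have hS : Summable fun p : Nat.Primes ↦ 4 / (y - 1 / 2) * ((p : ℕ) : ℝ) ^ (-(y + 1 / 2)) :=
      (Nat.Primes.summable_rpow.2 (by linarith)).mul_left _
    refine hS.of_nonneg_of_le (fun p ↦ ?_) (fun p ↦ ?_)
    · refine mul_nonneg (mul_nonneg (hlog0 _) (Real.rpow_nonneg (Nat.cast_nonneg _) _)) ?_
      exact inv_nonneg.2 (by linarith [hr1 p])
    · have hp2 : (2 : ℝ) ≤ ((p : ℕ) : ℝ) := by exact_mod_cast p.prop.two_le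
      have hp0 : (0 : ℝ) < ((p : ℕ) : ℝ) := by linarith
      have hlog : Real.log ((p : ℕ) : ℝ) ≤ ((p : ℕ) : ℝ) ^ (y - 1 / 2) / (y - 1 / 2) :=
        Real.log_le_rpow_div hp0.le hδ
      have hinv : (1 - ((p : ℕ) : ℝ) ^ (-y))⁻¹ ≤ 4 := by
        rw [inv_le_comm₀ (by linarith [hr1 p]) (by norm_num)]
        linarith [hr1 p]
      have hsplit : ((p : ℕ) : ℝ) ^ (y - 1 / 2) * ((p : ℕ) : ℝ) ^ (-(2 * y)) =
          ((p : ℕ) : ℝ) ^ (-(y + 1 / 2)) := by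
        rw [← Real.rpow_add hp0]
        congr 1
        ring
      have hA : 0 ≤ ((p : ℕ) : ℝ) ^ (-(2 * y)) := Real.rpow_nonneg hp0.le _
      have hinv0 : 0 ≤ (1 - ((p : ℕ) : ℝ) ^ (-y))⁻¹ := inv_nonneg.2 (by linarith [hr1 p])
      have hB : 0 ≤ ((p : ℕ) : ℝ) ^ (y - 1 / 2) / (y - 1 / 2) := div_nonneg (Real.rpow_nonneg hp0.le _) hδ.le
      calc Real.log ((p : ℕ) : ℝ) * ((p : ℕ) : ℝ) ^ (-(2 * y)) * (1 - ((p : ℕ) : ℝ) ^ (-y))⁻¹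
          ≤ (((p : ℕ) : ℝ) ^ (y - 1 / 2) / (y - 1 / 2)) * ((p : ℕ) : ℝ) ^ (-(2 * y)) * 4 :=
            mul_le_mul (mul_le_mul_of_nonneg_right hlog hA) hinv hinv0 (mul_nonneg hB hA)
        _ = 4 / (y - 1 / 2) * (((p : ℕ) : ℝ) ^ (y - 1 / 2) * ((p : ℕ) : ℝ) ^ (-(2 * y))) := by
            field_simp
        _ = 4 / (y - 1 / 2) * ((p : ℕ) : ℝ) ^ (-(y + 1 / 2)) := by rw [hsplit]

/-- **The abscissa of absolute convergence of `L(Λ·𝟙_{not prime}, ·)` is at most `1/2`.**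
[cite: Suzuki2025Chebyshev, §4.2 eq. (4.11)] -/
theorem abscissaOfAbsConv_vonMangoldt_nonPrime_le :
    LSeries.abscissaOfAbsConv (fun n ↦ ((if n.Prime then 0 else Λ n : ℝ) : ℂ)) ≤ (1 / 2 : ℝ) := by
  refine LSeries.abscissaOfAbsConv_le_of_forall_lt_LSeriesSummable fun y hy ↦ ?_
  refine Summable.of_norm ?_
  refine (summable_vonMangoldt_nonPrime_mul_rpow hy).congr fun n ↦ ?_
  rw [LSeries.norm_term_eq]
  rcases eq_or_ne n 0 with rfl | hn
  · simp
  have hn0 : (0 : ℝ) < n := by exact_mod_cast Nat.pos_of_ne_zero hn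
  rw [if_neg hn, Complex.norm_real, Complex.ofReal_re, Real.rpow_neg hn0.le]
  have h0 : 0 ≤ (if n.Prime then 0 else Λ n : ℝ) := by split_ifs <;> simp [vonMangoldt_nonneg]
  rw [Real.norm_of_nonneg h0, div_eq_mul_inv]

/-- `P(S) = 2 + (1 − 2S)·L(Λ·𝟙_{not prime}, ½ + S)` is holomorphic on `Re S > 0`.
[cite: Suzuki2025Chebyshev, §4.2 eq. (4.11)] -/
theorem differentiableOn_P :
    DifferentiableOn ℂ (fun s : ℂ ↦ 2 + (1 - 2 * s) *
      L (fun n ↦ ((if n.Prime then 0 else Λ n : ℝ) : ℂ)) (1 / 2 + s)) {s : ℂ | 0 < s.re} := by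
  intro s hs
  have hs' : 0 < s.re := hs
  set f : ℕ → ℂ := fun n ↦ ((if n.Prime then 0 else Λ n : ℝ) : ℂ) with hf
  have hmem : (1 / 2 + s) ∈ {w : ℂ | LSeries.abscissaOfAbsConv f < w.re} := by
    have h1 := abscissaOfAbsConv_vonMangoldt_nonPrime_le
    have h2 : ((1 / 2 : ℝ) : EReal) < (((1 / 2 + s).re : ℝ) : EReal) := by
      rw [EReal.coe_lt_coe_iff]
      simp
      linarith
    exact lt_of_le_of_lt h1 h2
  have hL : DifferentiableAt ℂ (LSeries f) (1 / 2 + s) :=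
    (LSeries_differentiableOn f).differentiableAt ((isOpen_re_gt_EReal _).mem_nhds hmem)
  have hcomp : DifferentiableAt ℂ (fun s : ℂ ↦ LSeries f (1 / 2 + s)) s :=
    hL.comp s (by fun_prop)
  exact ((differentiableAt_const _).add ((by fun_prop : DifferentiableAt ℂ (fun s : ℂ ↦ 1 - 2 * s) s).mul
    hcomp)).differentiableWithinAt

/-- The prime part of `L(Λ, ·)`: for `Re w > 1`, `Σ_p log p · p^{-w} = L(Λ, w) − L(Λ·𝟙_{not prime}, w)`.
[cite: Suzuki2025Chebyshev, §4.2 (decomposition `f_χ = f₁ + f₂ + f₃`)] -/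
theorem LSeries_primeLog_eq {w : ℂ} (hw : 1 < w.re) :
    L (fun n ↦ ((if n.Prime then Real.log n else 0 : ℝ) : ℂ)) w =
      L ↗Λ w - L (fun n ↦ ((if n.Prime then 0 else Λ n : ℝ) : ℂ)) w := by
  have hN0 : ∀ n : ℕ, 0 ≤ (if n.Prime then 0 else Λ n : ℝ) := fun n ↦ by
    split_ifs <;> simp [vonMangoldt_nonneg]
  have hNle : ∀ n : ℕ, (if n.Prime then 0 else Λ n : ℝ) ≤ Λ n := fun n ↦ by
    split_ifs <;> simp [vonMangoldt_nonneg]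
  rw [← LSeries_sub (LSeriesSummable_vonMangoldt hw) (lseriesSummable hN0 hNle hw)]
  congr 1
  funext n
  simp only [Pi.sub_apply]
  split_ifs with hp
  · rw [vonMangoldt_apply_prime hp]
    push_cast
    ring
  · push_cast
    ring

end HalfLinePrimeOnlyLandau

/-! ## Theorem 5 (first assertion) -/

/-- **Suzuki 2025, Theorem 5 (first assertion), PROVED** — discharge of the named fact `Suzuki2025Chebyshev_thm5`
(«The RH holds assuming `lim_{x→∞} Σ_{p ≤ xe²} log p · √(x/p) log(x/p) = −∞`»). Proof (§4.3 with §4.2 of the paper, in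
the Landau variable of the tree's `Suzuki2025_thm2`): the hypothesis makes
`G₁(t) = Σ_{p ≤ e^t} (log p/√p)(2 − t + log p)` non-negative for large `t`; its Laplace transform is
`((1 − 2S)·ζ₁'/ζ₁(½+S) + 2 + (1 − 2S)·L(Λ·𝟙_{not prime}, ½+S))/S²` for `Re S > 1`
(`HalfLinePrimeOnlyLandau.laplace_two_count_sub_weighted`, `HalfLinePrimeOnlyLandau.LSeries_primeLog_eq`,
`logDeriv_riemannZeta₁_eq_of_one_lt_re`), the correction being holomorphic on `Re S > 0`
(`HalfLinePrimeOnlyLandau.differentiableOn_P`), and Landau's theorem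
(`HalfLinePrimeSumLandau.riemannHypothesis_of_laplace_eq_mul`) gives RH.
[cite: Suzuki2025Chebyshev, §1.2 Thm 5 (first assertion); proof §4.3, §4.2 (4.11), §2 Prop 1] -/
theorem Suzuki2025Chebyshev_thm5_holds : Suzuki2025Chebyshev_thm5 := by
  intro hlim
  -- the hypothesis, eventually: the prime sum is `≤ 0` for `x ≥ x₀ ≥ 1`
  obtain ⟨x₁, hx₁⟩ := Filter.eventually_atTop.1 (hlim.eventually (Filter.eventually_le_atBot (0 : ℝ)))
  set x₀ : ℝ := max x₁ 1 with hx₀_def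
  have hx₀1 : 1 ≤ x₀ := le_max_right _ _
  have hx₀0 : 0 < x₀ := by linarith
  have hyp : ∀ x : ℝ, x₀ ≤ x →
      ∑ p ∈ (Finset.Icc 1 ⌊x * Real.exp 2⌋₊).filter Nat.Prime,
        Real.log p * Real.sqrt (x / p) * Real.log (x / p) ≤ 0 :=
    fun x hx ↦ hx₁ x (le_trans (le_max_left _ _) hx)
  -- the coefficients: `dP = log · 𝟙_{prime}` (`≤ Λ`), `dN = Λ · 𝟙_{not prime}`
  set dP : ℕ → ℝ := fun n ↦ if n.Prime then Real.log n else 0 with hdP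
  have hdP0 : ∀ n, 0 ≤ dP n := fun n ↦ by
    simp only [hdP]
    split_ifs
    · exact Real.log_natCast_nonneg n
    · exact le_rfl
  have hdPle : ∀ n, dP n ≤ Λ n := fun n ↦ by
    simp only [hdP]
    split_ifs with hp
    · rw [vonMangoldt_apply_prime hp]
    · exact vonMangoldt_nonneg
  -- the one-signed function `G₁ = 2A − φ` of the primes
  set G : ℝ → ℝ := fun t ↦
    2 * (∑ n ∈ Finset.Icc 1 ⌊Real.exp t⌋₊, dP n / Real.sqrt n)
      - ∑ n ∈ Finset.Icc 1 ⌊Real.exp t⌋₊, dP n / Real.sqrt n * (t - Real.log n) with hG_def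
  have hGm : Measurable G :=
    ((HalfLinePrimeOnlyLandau.measurable_count hdP0).const_mul 2).sub
      (HalfLinePrimeOnlyLandau.measurable_weighted hdP0)
  refine HalfLinePrimeSumLandau.riemannHypothesis_of_laplace_eq_mul (G := G) hGm
    (t₀ := Real.log x₀ + 2) (fun t ht ↦ ?_) ?_ (c := fun s ↦ 1 - 2 * s)
    (P := fun s ↦ 2 + (1 - 2 * s) * L (fun n ↦ ((if n.Prime then 0 else Λ n : ℝ) : ℂ)) (1 / 2 + s))
    (by fun_prop) (fun s _ hs' hcs ↦ ?_) HalfLinePrimeOnlyLandau.differentiableOn_P (fun s hs ↦ ?_)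
  · -- non-negativity beyond `log x₀ + 2`, from the hypothesis at `x = e^{t−2}`
    set x : ℝ := Real.exp (t - 2) with hx_def
    have hx₀x : x₀ ≤ x := by
      rw [hx_def, ← Real.exp_log hx₀0]
      exact Real.exp_le_exp.2 (by linarith)
    have hx0 : 0 < x := Real.exp_pos _
    have hxe : x * Real.exp 2 = Real.exp t := by
      rw [hx_def, ← Real.exp_add]
      congr 1
      ring
    have hS := hyp x hx₀x
    rw [hxe, Finset.sum_filter] at hS
    have hkey : Real.sqrt x * G t =
        -∑ n ∈ Finset.Icc 1 ⌊Real.exp t⌋₊,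
          (if n.Prime then Real.log n * Real.sqrt (x / n) * Real.log (x / n) else 0) := by
      simp only [hG_def]
      rw [mul_sub, Finset.mul_sum, Finset.mul_sum, Finset.mul_sum, ← Finset.sum_sub_distrib,
        ← Finset.sum_neg_distrib]
      refine Finset.sum_congr rfl fun n hn ↦ ?_
      rw [Finset.mem_Icc] at hn
      have hn0 : (0 : ℝ) < n := by exact_mod_cast hn.1
      simp only [hdP]
      split_ifs with hp
      · rw [Real.sqrt_div hx0.le, Real.log_div hx0.ne' hn0.ne', hx_def, Real.log_exp]
        have hsq : Real.sqrt n ≠ 0 := Real.sqrt_ne_zero'.2 hn0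
        field_simp
        ring
      · simp
    have hprod : 0 ≤ Real.sqrt x * G t := by
      rw [hkey, neg_nonneg]
      exact hS
    have hsx : 0 < Real.sqrt x := Real.sqrt_pos.2 hx0
    nlinarith
  · -- integrability of `G(t) e^{−t}`
    have := (HalfLinePrimeOnlyLandau.laplace_two_count_sub_weighted hdP0 hdPle (s := 1) (by norm_num)).1
    simpa [hG_def] using this
  · -- `c(S) = 1 − 2S ≠ 0` for `Re S < 1/2`
    have := congrArg Complex.re (sub_eq_zero.1 hcs)
    simp at this
    linarith
  · -- the transform
    have htr := (HalfLinePrimeOnlyLandau.laplace_two_count_sub_weighted hdP0 hdPle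
      (s := s) (by linarith)).2
    have hG' : ∀ t : ℝ, (G t : ℂ) =
        ((2 * (∑ n ∈ Finset.Icc 1 ⌊Real.exp t⌋₊, dP n / Real.sqrt n)
            - ∑ n ∈ Finset.Icc 1 ⌊Real.exp t⌋₊, dP n / Real.sqrt n * (t - Real.log n) : ℝ) : ℂ) :=
      fun t ↦ by simp only [hG_def]
    simp_rw [hG']
    rw [htr]
    have hw : 1 < (1 / 2 + s : ℂ).re := by simp; linarith
    have hP : L (fun n ↦ ((dP n : ℝ) : ℂ)) (1 / 2 + s) =
        L ↗Λ (1 / 2 + s) - L (fun n ↦ ((if n.Prime then 0 else Λ n : ℝ) : ℂ)) (1 / 2 + s) :=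
      HalfLinePrimeOnlyLandau.LSeries_primeLog_eq hw
    have hL : L ↗Λ (1 / 2 + s) = 1 / (1 / 2 + s - 1) - logDeriv riemannZeta₁ (1 / 2 + s) := by
      have := logDeriv_riemannZeta₁_eq_of_one_lt_re (s := 1 / 2 + s) hw
      rw [this]
      ring
    rw [hP, hL]
    have hs0 : s ≠ 0 := fun h ↦ by rw [h, zero_re] at hs; linarith
    have hq : (2 * s - 1 : ℂ) ≠ 0 := by
      intro h
      have := congrArg Complex.re h
      simp at this
      linarith
    set LD := logDeriv riemannZeta₁ (1 / 2 + s)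
    set LN := L (fun n ↦ ((if n.Prime then 0 else Λ n : ℝ) : ℂ)) (1 / 2 + s)
    have e3 : (1 / 2 + s - 1 : ℂ) = (2 * s - 1) / 2 := by ring
    rw [e3]
    field_simp
    ring

end Literature.NumberTheory.LFunctions

end
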